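import Summits.MatrixMultiplication.OmegaCensus.SmallFormats.RankOnePlaneCapLattice
import Summits.MatrixMultiplication.OmegaCensus.SmallFormats.RankOnePlaneCapGaugeHeads
import Summits.MatrixMultiplication.OmegaCensus.SmallFormats.MatMul22nRankGF3LowerBound
import HarnessLib

/-!
# ω-census family (a): the TOP-LEVEL reduction of the `𝔽₃` `⟨2,2,5⟩@17` X-marginal census

Cell `pub-omega` (unit `pub-omega-tensor`, gen 29), topic `Summits/MatrixMultiplication/OmegaCensus`
(sub-folder `SmallFormats`). Framing (verbatim): lottery ticket; floor = certified bounds/negative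
ranges. HONEST FRAMING: the typed SKELETON of the census's eventual claim — not the claim. What the
kernel proves here: the open rung `R_𝔽₃(⟨2,2,5⟩) ∈ {17, 18}` (tree:
`tensorRank_matMulTensor_225_gf3_mem`) closes at `18` AS SOON AS every 17-product `𝔽₃`-computation
of `⟨2,2,5⟩` whose 17 X-forms are NORMALISED (coefficient vector `(u₀₀,u₀₁,u₁₀,u₁₁)` with first
nonzero entry `1` — the census's 40 classes 'abcd') is shown impossible; and the symmetries the
census quotients by (`X ↦ P X Q`, transpose) act on computations without leaving the format. The
census itself (62 018 orbits of admissible multisets, their exclusion) is engine-side and is NOT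
asserted here. Nothing in this file is a bound on `ω` or the statement 'R_𝔽₃(⟨2,2,5⟩) = 18'.

* `exists_bilinComp_erase`: a product whose X-form is `0` can be dropped.
* `f_ne_zero_of_card_seventeen`: hence in a 17-product `𝔽₃`-computation of `⟨2,2,5⟩` no X-form
  vanishes (16 products would contradict the kernel floor `seventeen_le_tensorRank_matMulTensor_225_gf3`).
* `exists_smul_mem_reps40` (`decide`): every nonzero `u ∈ 𝔽₃⁴` is a nonzero multiple of one of the
  40 normalised classes.
* `eighteen_le_tensorRank_225_gf3_of_census`: IF no 17-product computation has all its X-forms in the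
  40 classes THEN `18 ≤ R_𝔽₃(⟨2,2,5⟩)` (with the Hopcroft–Kerr ceiling: `= 18`).
* `exists_XsideTransform` (any field): for invertible `P` (`c × c`), `Q` (`m × m`) a computation with X-forms
  `f_i` yields one with X-forms `X ↦ f_i(P X Q)` (the `GL₂ × GL₂` action on marginals; transpose is
  `exists_transposeDual'`), so one representative per orbit suffices.
-/

namespace Summit.MatrixMultiplication.OmegaCensus.RankOnePlaneCapGeneral

open Module Matrix Literature.Computability.AlgebraicComplexity

variable {k : Type*} [Field k]

section Erase

variable {U V W : Type*} [AddCommGroup U] [Module k U] [AddCommGroup V] [Module k V]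
  [AddCommGroup W] [Module k W] {φ : U →ₗ[k] V →ₗ[k] W} {ι : Type*} [Fintype ι] [DecidableEq ι]

/-- **Dropping a dead product.** If the X-form of product `i₀` vanishes, the other products still
compute `φ`. -/
theorem exists_bilinComp_erase (β : BilinComp φ ι) {i₀ : ι} (h : β.f i₀ = 0) :
    Nonempty (BilinComp φ {i // i ≠ i₀}) := by
  refine ⟨{ f := fun i => β.f i.1, g := fun i => β.g i.1, w := fun i => β.w i.1,
            map_eq_sum := fun u v => ?_ }⟩
  rw [β.map_eq_sum]
  have h1 : (∑ i, (β.f i u * β.g i v) • β.w i) =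
      ∑ i ∈ Finset.univ.erase i₀, (β.f i u * β.g i v) • β.w i := by
    rw [← Finset.sum_erase_add _ _ (Finset.mem_univ i₀), h]
    simp
  rw [h1]
  exact Finset.sum_subtype (Finset.univ.erase i₀) (fun i => by simp)
    (fun i => (β.f i u * β.g i v) • β.w i)

end Erase

/-- **The X-side `GL₂ × GL₂` action** (any field, any `⟨c,m,n⟩`): for `P P' = 1` (`c × c`) and
`Q' Q = 1` (`m × m`), a computation `(f_i, g_i, W_i)` of `XY` yields the computation
`(X ↦ f_i(P X Q), Y ↦ g_i(Q' Y), P' W_i)` — the X-marginal moves by `X ↦ P X Q`. -/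
theorem exists_XsideTransform {c m n : ℕ} {ι : Type*} [Fintype ι]
    (β : BilinComp (mulBilin k c m n) ι) (P P' : Matrix (Fin c) (Fin c) k)
    (Q Q' : Matrix (Fin m) (Fin m) k) (hP : P * P' = 1) (hQ : Q' * Q = 1) :
    ∃ β' : BilinComp (mulBilin k c m n) ι,
      (∀ i X, β'.f i X = β.f i (P * X * Q)) ∧ (∀ i Y, β'.g i Y = β.g i (Q' * Y)) ∧
      (∀ i, β'.w i = P' * β.w i) := by
  refine ⟨β.comap ((mulLeftLin k P).comp (mulRightLin k Q)) (mulLeftLin k Q') (mulLeftLin k P')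
    (fun X Y => ?_), fun i X => ?_, fun i Y => rfl, fun i => rfl⟩
  · simp only [mulBilin_apply, mulLeftLin_apply, mulRightLin_apply, LinearMap.comp_apply]
    have hP' : P' * P = 1 := mul_eq_one_comm.mp hP
    have hQ' : Q * Q' = 1 := mul_eq_one_comm.mp hQ
    rw [show P' * (P * (X * Q) * (Q' * Y)) = (P' * P) * X * ((Q * Q') * Y) by
      simp only [Matrix.mul_assoc], hP', hQ', Matrix.one_mul, Matrix.one_mul]
  · simp [BilinComp.comap, Matrix.mul_assoc]

/-- **No dead product at length 17.** In a 17-product `𝔽₃`-computation of `⟨2,2,5⟩` every X-form is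
nonzero: otherwise 16 products compute `⟨2,2,5⟩`, against the kernel floor `R_𝔽₃(⟨2,2,5⟩) ≥ 17`. -/
theorem f_ne_zero_of_card_seventeen {ι : Type} [Fintype ι] [DecidableEq ι]
    (h17 : Fintype.card ι = 17) (β : BilinComp (mulBilin (ZMod 3) 2 2 5) ι) (i₀ : ι) :
    β.f i₀ ≠ 0 := by
  intro h
  obtain ⟨β'⟩ := exists_bilinComp_erase β h
  have h1 := RankRowIncrement.tensorRank_le_card β'
  have h2 := SmallFormats.seventeen_le_tensorRank_matMulTensor_225_gf3
  have h3 : Fintype.card {i // i ≠ i₀} = 16 := by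
    rw [Fintype.card_subtype_compl, h17, Fintype.card_unique]
  omega

/-- The 40 normalised X-form classes over `𝔽₃` ('abcd' = `(u₀₀,u₀₁,u₁₀,u₁₁)`, first nonzero digit
`1`): every nonzero coefficient vector is a nonzero multiple of one of them. -/
theorem exists_smul_mem_reps40 : ∀ u : Fin 4 → ZMod 3, u ≠ 0 → ∃ c : ZMod 3, c ≠ 0 ∧
    c • u ∈ ([![0, 0, 0, 1], ![0, 0, 1, 0], ![0, 0, 1, 1], ![0, 0, 1, 2], ![0, 1, 0, 0], ![0, 1, 0, 1], ![0, 1, 0, 2], ![0, 1, 1, 0], ![0, 1, 1, 1], ![0, 1, 1, 2], ![0, 1, 2, 0], ![0, 1, 2, 1], ![0, 1, 2, 2], ![1, 0, 0, 0], ![1, 0, 0, 1], ![1, 0, 0, 2], ![1, 0, 1, 0], ![1, 0, 1, 1], ![1, 0, 1, 2], ![1, 0, 2, 0], ![1, 0, 2, 1], ![1, 0, 2, 2], ![1, 1, 0, 0], ![1, 1, 0, 1], ![1, 1, 0, 2], ![1, 1, 1, 0], ![1, 1, 1, 1], ![1, 1, 1, 2], ![1, 1, 2, 0], ![1, 1,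 2, 1], ![1, 1, 2, 2], ![1, 2, 0, 0], ![1, 2, 0, 1], ![1, 2, 0, 2], ![1, 2, 1, 0], ![1, 2, 1, 1], ![1, 2, 1, 2], ![1, 2, 2, 0], ![1, 2, 2, 1], ![1, 2, 2, 2]] : List (Fin 4 → ZMod 3)) := by
  decide

/-- **Census reduction.** IF no 17-product `𝔽₃`-computation of `⟨2,2,5⟩` has all 17 X-forms in the
40 normalised classes (coefficient vector `(f(E₀₀), f(E₀₁), f(E₁₀), f(E₁₁))`), THEN
`18 ≤ R_𝔽₃(⟨2,2,5⟩)` — hence `= 18` with the Hopcroft–Kerr ceiling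
(`tensorRank_matMulTensor_225_gf3_mem`). The hypothesis is what the X-marginal census is designed
to establish orbit by orbit; it is NOT proved here. -/
theorem eighteen_le_tensorRank_225_gf3_of_census
    (H : ∀ β : BilinComp (mulBilin (ZMod 3) 2 2 5) (Fin 17),
      ¬ ∀ i, (![β.f i (Matrix.single 0 0 1), β.f i (Matrix.single 0 1 1),
              β.f i (Matrix.single 1 0 1), β.f i (Matrix.single 1 1 1)] : Fin 4 → ZMod 3) ∈
        ([![0, 0, 0, 1], ![0, 0, 1, 0], ![0, 0, 1, 1], ![0, 0, 1, 2], ![0, 1, 0, 0], ![0, 1, 0, 1], ![0, 1, 0, 2], ![0, 1, 1, 0], ![0, 1, 1, 1], ![0, 1, 1, 2], ![0, 1, 2, 0], ![0, 1, 2, 1], ![0, 1, 2, 2], ![1, 0, 0, 0], ![1, 0, 0, 1], ![1, 0, 0, 2], ![1, 0, 1, 0], ![1, 0, 1, 1], ![1, 0, 1, 2], ![1, 0, 2, 0], ![1, 0, 2, 1], ![1, 0, 2, 2], ![1, 1, 0, 0], ![1, 1, 0, 1], ![1, 1, 0, 2], ![1, 1, 1, 0], ![1, 1, 1, 1], ![1,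 1, 1, 2], ![1, 1, 2, 0], ![1, 1, 2, 1], ![1, 1, 2, 2], ![1, 2, 0, 0], ![1, 2, 0, 1], ![1, 2, 0, 2], ![1, 2, 1, 0], ![1, 2, 1, 1], ![1, 2, 1, 2], ![1, 2, 2, 0], ![1, 2, 2, 1], ![1, 2, 2, 2]] : List (Fin 4 → ZMod 3))) :
    18 ≤ tensorRank (matMulTensor (ZMod 3) 2 2 5) := by
  by_contra hlt
  obtain ⟨β⟩ := exists_bilinComp_of_tensorRank_le (k := ZMod 3) (c := 2) (m := 2) (n := 5)
    (r := 17) (by omega)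
  -- every X-form is nonzero, hence so is its coefficient vector
  have hne := f_ne_zero_of_card_seventeen (by simp) β
  have hvec : ∀ i, (![β.f i (Matrix.single 0 0 1), β.f i (Matrix.single 0 1 1),
      β.f i (Matrix.single 1 0 1), β.f i (Matrix.single 1 1 1)] : Fin 4 → ZMod 3) ≠ 0 := by
    intro i hv
    apply hne i
    ext X
    rw [dual_apply_eq_sum_single (β.f i) X, LinearMap.zero_apply]
    have h00 := congrFun hv 0; have h01 := congrFun hv 1; have h10 := congrFun hv 2
    have h11 := congrFun hv 3
    simp only [Matrix.cons_val_zero, Matrix.cons_val_one, Pi.zero_apply,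
      Matrix.cons_val] at h00 h01 h10 h11
    simp [Fin.sum_univ_two, h00, h01, h10, h11]
  -- rescale each product so that its X-form is normalised
  choose c hc hmem using fun i => exists_smul_mem_reps40 _ (hvec i)
  obtain ⟨β', hf', -, -⟩ := exists_rescale β c (fun i => (c i)⁻¹) (fun i => mul_inv_cancel₀ (hc i))
  refine H β' fun i => ?_
  have : (![β'.f i (Matrix.single 0 0 1), β'.f i (Matrix.single 0 1 1),
      β'.f i (Matrix.single 1 0 1), β'.f i (Matrix.single 1 1 1)] : Fin 4 → ZMod 3) =
      c i • ![β.f i (Matrix.single 0 0 1), β.f i (Matrix.single 0 1 1),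
        β.f i (Matrix.single 1 0 1), β.f i (Matrix.single 1 1 1)] := by
    ext j; fin_cases j <;> simp [hf']
  rw [this]
  exact hmem i

end Summit.MatrixMultiplication.OmegaCensus.RankOnePlaneCapGeneral
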